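import Summits.QuantumFields.YangMills.Theorems.UnitScaleTiltFluctuationComparisonRegPrRepAtHeightsLowerRow
import Summits.QuantumFields.Balaban3D.Proofs.FibreClash
import HarnessLib

/-!
# Route `UnitScaleTilt` — crux `FluctuationComparisonRegPrL` (stmt-QuantumFields-19935), v5h STUB 3′ `stub_alphaTwoRunOfLane`, conjunct (A)
# `RepAtHeights`: THE UPPER ONE-STEP TRIVIAL ENVELOPE OF THE LANE'S DATUM FROM THE v2 (α) ROWS **AND EXACT HAAR COMPATIBILITY** —
# finding F-g3-1 in constructive form: `OfV2At ∧ HaarCompatT3 F ⇒ RepAtHeights (dataT3c …)` (support file `--supports stmt-QuantumFields-19935`)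

Fleet seat `ym-ust-19201-p2` (gen 3, socket pen); split card `CARD-19935-STUB3prime-split.md` (evidence #18 on the item), finding F-g3-1 §2; continues
`…RepAtHeightsLowerRow` (p503151: the LOWER one-step row of `OfV2At.dataT3c` from the rows alone).
WHAT THIS FILE PROVES.  §1 (abstract carrier): the EXPONENT form of LQB's `ineq41_succ_of_leaves` AT THE TRIVIAL HISTORY — from the upper step leaves the
one-step piece exponent (55)·(58) at `Ω_{k+1} = T_η` is BELOW the (41)-exponent of level `k+1` (`ineq41_exponent_succ_le_triv`).  §2 (generic AC tower, the heart
of finding F-g3-1): under EXACT Haar compatibility of the averaging at the levels below `k` the AC tower's trivial-history mass `massRecAC … k triv` (the floored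
iterated Radon–Nikodym Jacobian, `MassesAC`) is `1` dU-a.e. (`massRecAC_triv_ae_eq_one_of_map`), and the transported trivial mass — the prefactor of the residual row
`Fibre49AC` at the trivial history — is `≤ 1` dV-a.e. (`transport_mass_triv_le_one_ae_of_map`).  §3 (the lane's datum): **`OfV2At.dataT3c_oneStepUpperTrivAt_of_haarCompat`**
— `HaarCompatT3 F →` for every run `K` and step `k < K`, `OneStepUpperTrivAt (dataT3c …) 𝔠.b₀ 𝔠.p₀ K k` (row `Fibre49AC` at the trivial history + §2 + §1 +
homogeneity for the route normalisation + the window dictionary `χB(ε₁) = 𝟙[PlaqSmall θBal(K−k)]`).  §4 **`OfV2At.repAtHeights_dataT3c_of_haarCompat : HaarCompatT3 F →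
thresholds → RepAtHeights (dataT3c …) 𝔠.b₀ 𝔠.p₀ ε₀`** — conjunct (A) of STUB 3′ at the lane's datum from the v2 package PLUS the one located leaf E6′, nothing else.
CONDITIONAL on `OfV2At F 𝔠 a₀ a₁` and `HaarCompatT3 F` (both hypothesis schemas; E6′ is NOT IN PRINT, pub-balaban3d DEPMAP v6 §16); nothing of Bałaban's is asserted.

References: T. Bałaban, CMP 102 (1985) 255–275 [Balaban1985UV3] ((22) p.261, (36) p.265, (41) p.266, (48)–(49) pp.267–268, (55)–(62) pp.269–271); CMP 98 (1985)
17–51 [Balaban1985Averaging] ((10) p.19).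
-/

set_option autoImplicit false

noncomputable section

namespace Summit.QuantumFields.YangMills.Theorems

open MeasureTheory Filter
open Literature.MathematicalPhysics.QuantumFieldTheory.Balaban1983to89
open Literature.MathematicalPhysics.QuantumFieldTheory.Balaban1983to89.B10
open Literature.MathematicalPhysics.QuantumFieldTheory.Balaban1983to89.B10SectAGathering
open Literature.MathematicalPhysics.QuantumFieldTheory.Balaban1983to89.AveragingRT (rnTransport)
open Literature.MathematicalPhysics.QuantumFieldTheory.Balaban1983to89.T3ContinuumYM3Torus
open Literature.MathematicalPhysics.QuantumFieldTheory.Balaban1983to89.T3UnitLawDensityEML (ℰp rt)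
open Literature.MathematicalPhysics.QuantumFieldTheory.Balaban1983to89.T3UnitScaleTilt (θBal)
open Literature.MathematicalPhysics.QuantumFieldTheory.Balaban1983to89.T3LevelShift (fieldShift)
open Literature.MathematicalPhysics.QuantumFieldTheory.Balaban1983to89.T3PrintedRegularMinimiser
open Literature.MathematicalPhysics.QuantumFieldTheory.Balaban1983to89.T3AlphaInputsAC
open Literature.MathematicalPhysics.QuantumFieldTheory.Balaban1983to89.T3AlphaInputsACTrivEnvelope
open Literature.MathematicalPhysics.QuantumFieldTheory.Balaban1985CMP102
open Literature.MathematicalPhysics.QuantumFieldTheory.Balaban1985CMP102.Setting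
open Summit.QuantumFields.Balaban3D.Carriers
open Summit.QuantumFields.Balaban3D.Proofs.Primitives
open Summit.QuantumFields.Balaban3D.Proofs.TowerAC
open Summit.QuantumFields.Balaban3D.Proofs.StandardAC
open Summit.QuantumFields.Balaban3D.Proofs.InputsAC
open Summit.QuantumFields.Balaban3D.Proofs.Bound55AC
open Summit.QuantumFields.Balaban3D.Proofs.Bound55Masses (chiB chiB_nonneg chiB_le_one measurable_chiB)
open Summit.QuantumFields.Balaban3D.Proofs.MassesAC
open Summit.QuantumFields.Balaban3D.Proofs.Thm2AC
open Summit.QuantumFields.Balaban3D.Proofs (Bound55Std.measurable_actionEta Bound55Std.actionEta_nonneg)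
open Summit.QuantumFields.YangMills.Theorems.LogComparisonRepAtHeights

/-! ## §1 The upper gathering at the trivial history, exponent form (abstract carrier) -/

namespace LogComparisonRepAtHeights

/-- **(36)/(41) GATHERING AT THE TRIVIAL HISTORY, EXPONENT FORM**: with `|Z_k| = 0` and `|B*| = |T*|` at the trivial history, the upper cumulant, representation,
vacuum, decomposition and normalisation leaves with `PintSucc`, `Estep62`, `RmSucc` give
`−mainT_{k+1}(triv) − E_k + (log σ₀ + d(𝔤) log g_k)|B*| + log Z^{(k)} + P_old + Z_k(triv) + Rm_k + log Fl ≤ −mainT_{k+1}(triv) + Pint_{k+1}(triv) − E_{k+1} + Z_{k+1}(triv) + Rm_{k+1}`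
pointwise — the `h = triv` instance of the per-history arithmetic inside LQB's `ineq41_succ_of_leaves` (p.271 «gathering together all the transformations and
estimates, we obtain the inductive inequality (41) for k replaced by k + 1»), re-derived with the exponent as conclusion. [cite: Balaban1985UV3, (36) p.265 and (41) p.271] -/
theorem ineq41_exponent_succ_le_triv {T : TowerRun} {k : ℕ} (P : StepPieces T k) {Cz C₁ C₂ Cv C₃ C₄ C₅ c₁ C₆ : ℝ}
    (hk : k + 1 ≤ T.K) (h58 : Cumulant58 P Cz C₁) (h60 : Repr33_60 P C₂) (hvac : VacuumWhole P Cv C₃)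
    (h61 : Decomp35_61 P C₄) (h35 : Norm35 P C₅) (hstar : StarCount P c₁) (hold : OldOutside P C₆)
    (hPint : PintSucc P) (hE : Estep62 P) (hR : RmSucc P (C₁ + C₂ + C₃ + C₄)) (U : T.Cfg (k + 1)) :
    -(T.mainT (k + 1) (T.triv (k + 1)) U) - T.Ecst k
        + (P.logσ₀ + P.dg * Real.log (T.g k)) * P.starB (T.triv (k + 1)) + P.logZU (T.triv (k + 1)) U + P.Pold (T.triv (k + 1)) U
        + T.Zterm k (P.proj (T.triv (k + 1))) + T.Rm k + P.logFl (T.triv (k + 1)) U ≤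
      -(T.mainT (k + 1) (T.triv (k + 1)) U) + T.Pint (k + 1) (T.triv (k + 1)) U - T.Ecst (k + 1)
        + T.Zterm (k + 1) (T.triv (k + 1)) + T.Rm (k + 1) := by
  have hEcst : T.Ecst (k + 1) = T.Ecst k - T.Estep k := by
    rw [T.Ecst_eq, T.Ecst_eq, Finset.sum_eq_sum_Ico_succ_bot (by omega : k < T.K)]
    ring
  have hZ0 : P.Zvol (T.triv (k + 1)) = 0 := P.Zvol_triv
  have hZk : T.Zterm k (P.proj (T.triv (k + 1))) = 0 := by rw [P.proj_triv]; exact T.Zterm_triv k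
  have hZk1 : T.Zterm (k + 1) (T.triv (k + 1)) = 0 := T.Zterm_triv (k + 1)
  have h58' := h58 (T.triv (k + 1)) U
  have h60' := abs_le.1 (h60 (T.triv (k + 1)) U)
  have hvac' := abs_le.1 (hvac (T.triv (k + 1)))
  have h61' := abs_le.1 (h61 (T.triv (k + 1)) U)
  have h35' := abs_le.1 (h35 (T.triv (k + 1)))
  have hold' := abs_le.1 (hold (T.triv (k + 1)) U)
  obtain ⟨hs0, hs1⟩ := hstar (T.triv (k + 1))
  have hR' : T.Rm k + (C₁ + C₂ + C₃ + C₄) * P.rem ≤ T.Rm (k + 1) := hR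
  rw [hZ0] at h58' hvac' h35' hold' hs1
  rw [hPint (T.triv (k + 1)) U, hEcst, hE, hZk, hZk1]
  have hstarEq : P.starB (T.triv (k + 1)) = P.starT := by
    have : P.starT - P.starB (T.triv (k + 1)) ≤ 0 := by simpa using hs1
    linarith
  rw [hstarEq]
  nlinarith [h58', h60'.1, h60'.2, hvac'.1, hvac'.2, h61'.1, h61'.2, h35'.1, h35'.2, hold'.1, hold'.2, hR']

/-- The same from a bundle of step leaves (`RmSucc` weakened from `max C₁ C₁′ + …`). [cite: Balaban1985UV3, (41) p.271] -/
theorem ineq41_exponent_succ_le_triv_of_leaves {T : TowerRun} {k : ℕ} (SL : StepLeaves T k) (hk : k + 1 ≤ T.K) (U : T.Cfg (k + 1)) :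
    -(T.mainT (k + 1) (T.triv (k + 1)) U) - T.Ecst k
        + (SL.P.logσ₀ + SL.P.dg * Real.log (T.g k)) * SL.P.starB (T.triv (k + 1)) + SL.P.logZU (T.triv (k + 1)) U
        + SL.P.Pold (T.triv (k + 1)) U + T.Zterm k (SL.P.proj (T.triv (k + 1))) + T.Rm k + SL.P.logFl (T.triv (k + 1)) U ≤
      -(T.mainT (k + 1) (T.triv (k + 1)) U) + T.Pint (k + 1) (T.triv (k + 1)) U - T.Ecst (k + 1)
        + T.Zterm (k + 1) (T.triv (k + 1)) + T.Rm (k + 1) :=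
  ineq41_exponent_succ_le_triv SL.P hk SL.cumulant58 SL.repr33_60 SL.vacuumWhole SL.decomp35_61 SL.norm35 SL.starCount
    SL.oldOutside SL.pintSucc SL.estep62 (SL.rmSucc.mono (by have := le_max_left SL.C₁ SL.C₁'; linarith)) U

end LogComparisonRepAtHeights

/-! ## §2 Exact Haar compatibility ⇒ the AC tower's trivial-history mass is `1` a.e. and its transport is `≤ 1` a.e. -/

namespace LogComparisonRepAtHeights

variable {P : Params} {G : Type} [GaugeGroup G] [MeasurableSpace G] [HaarData G]
  (M₁ : ℕ) (Rcol : ℕ → ℕ) (εL εS : ℕ → ℝ) (av : ∀ j, Averaging P j G)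

/-- **UNDER EXACT HAAR COMPATIBILITY THE TRIVIAL-HISTORY MASS OF THE AC TOWER IS `1` dU-A.E.** at every level `k ≤ m + K + 1`: `m_0 = 1`;
`m_{k+1}(triv) = max 1 (T_k[w_k(triv)·m_k(triv)])` (`MassesAC.massRecAC_triv_succ`) with `w_k(triv) = 1` (`stepWeight_triv`), `m_k(triv) = 1` a.e. (induction; the transport
sees only the a.e. class, `rnTransport_congr_ae`) and `T_k 1 ≤ 1` a.e. (`Transport48.rnTransport_le_one_ae`, which IS the Haar compatibility `Ū_*(dU) = dV`).  This is the
mechanism of finding F-g3-1: without the compatibility the floor keeps the Jacobian `T_k 1` inside the mass. [cite: Balaban1985Averaging, (10) p.19] -/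
theorem massRecAC_triv_ae_eq_one_of_map (hmeas : ∀ j, Measurable (av j).avg)
    (hmap : ∀ j, j + 1 ≤ P.m + P.K → (fieldMeasure P j G).map (av j).avg = fieldMeasure P (j + 1) G) :
    ∀ k, k ≤ P.m + P.K →
      massRecAC M₁ Rcol εL εS av k (Hist.triv P k) =ᵐ[fieldMeasure P k G] fun _ => (1 : ℝ)
  | 0, _ => Eventually.of_forall fun V => massRecAC_zero M₁ Rcol εL εS av _ V
  | k + 1, hk => by
    have ih := massRecAC_triv_ae_eq_one_of_map hmeas hmap k (by omega)
    -- the integrand of the recursion is `1` a.e.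
    have hint1 : (fun U => stepWeight M₁ Rcol εL εS k (Hist.triv P (k + 1)) U * massRecAC M₁ Rcol εL εS av k (Hist.triv P k) U)
        =ᵐ[fieldMeasure P k G] fun _ => (1 : ℝ) := by
      filter_upwards [ih] with U hU
      rw [stepWeight_triv M₁ Rcol εL εS (by omega) U, hU, one_mul]
    have hcongr : rnTransport (av k).avg
          (fun U => stepWeight M₁ Rcol εL εS k (Hist.triv P (k + 1)) U * massRecAC M₁ Rcol εL εS av k (Hist.triv P k) U) =
        rnTransport (av k).avg (fun _ => (1 : ℝ)) :=
      rnTransport_congr_ae hint1 (fun U => mul_nonneg (stepWeight_nonneg M₁ Rcol εL εS k _ U) (massRecAC_nonneg M₁ Rcol εL εS av k _ U))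
        (fun _ => zero_le_one)
    have hT1 := Balaban3D.Proofs.Transport48.rnTransport_le_one_ae (hmeas k) (hmap k hk) (φ := fun _ => (1 : ℝ)) measurable_const
      (fun _ => zero_le_one) (fun _ => le_rfl)
    filter_upwards [hT1] with V hV
    rw [massRecAC_triv_succ, hcongr]
    exact max_eq_left hV

/-- **… AND ITS TRANSPORT — THE PREFACTOR OF `Fibre49AC` AT THE TRIVIAL HISTORY — IS `≤ 1` dV-A.E.**: `T_k[w_k(triv)·m_k(triv)] ≤ 1` a.e. for `k + 1 ≤ m + K`.
[cite: Balaban1985Averaging, (10) p.19] -/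
theorem transport_mass_triv_le_one_ae_of_map (hmeas : ∀ j, Measurable (av j).avg)
    (hmap : ∀ j, j + 1 ≤ P.m + P.K → (fieldMeasure P j G).map (av j).avg = fieldMeasure P (j + 1) G) (k : ℕ) (hk : k + 1 ≤ P.m + P.K) :
    rnTransport (av k).avg
        (fun U => stepWeight M₁ Rcol εL εS k (Hist.triv P (k + 1)) U * massRecAC M₁ Rcol εL εS av k (Hist.triv P k) U)
      ≤ᵐ[fieldMeasure P (k + 1) G] fun _ => (1 : ℝ) := by
  have ih := massRecAC_triv_ae_eq_one_of_map M₁ Rcol εL εS av hmeas hmap k (by omega)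
  have hint1 : (fun U => stepWeight M₁ Rcol εL εS k (Hist.triv P (k + 1)) U * massRecAC M₁ Rcol εL εS av k (Hist.triv P k) U)
      =ᵐ[fieldMeasure P k G] fun _ => (1 : ℝ) := by
    filter_upwards [ih] with U hU
    rw [stepWeight_triv M₁ Rcol εL εS (by omega) U, hU, one_mul]
  have hcongr : rnTransport (av k).avg
        (fun U => stepWeight M₁ Rcol εL εS k (Hist.triv P (k + 1)) U * massRecAC M₁ Rcol εL εS av k (Hist.triv P k) U) =
      rnTransport (av k).avg (fun _ => (1 : ℝ)) :=
    rnTransport_congr_ae hint1 (fun U => mul_nonneg (stepWeight_nonneg M₁ Rcol εL εS k _ U) (massRecAC_nonneg M₁ Rcol εL εS av k _ U))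
      (fun _ => zero_le_one)
  rw [hcongr]
  exact Balaban3D.Proofs.Transport48.rnTransport_le_one_ae (hmeas k) (hmap k hk) (φ := fun _ => (1 : ℝ)) measurable_const
    (fun _ => zero_le_one) (fun _ => le_rfl)

end LogComparisonRepAtHeights

/-! ## §3 The upper one-step trivial envelope of the lane's datum from the (α) rows and exact Haar compatibility -/

section Upper

variable {F : T3Family} {𝔠 : AlphaConsts F.L (suGroupModel 2).N} {a₀ a₁ : ℝ}
  (h : AlphaInputsT3AC.OfV2At F 𝔠 a₀ a₁) (hc : 0 < a₀ ∧ 0 < a₁ ∧ 𝔠.B₃ * a₁ ≤ a₀) (γ : ℝ) (hγ : 0 < γ)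
  (hγ1 : γ ≤ (min 𝔠.gamma0 1) ^ 2) (π : AlphaInputsT3AC.PolymerT3 F)

open Classical in
/-- **THE UPPER ONE-STEP TRIVIAL ENVELOPE OF THE LANE'S DATUM FROM THE (α) ROWS AND EXACT HAAR COMPATIBILITY** (finding F-g3-1, constructive form): for every
run `K` and step `k < K`, `HaarCompatT3 F → OneStepUpperTrivAt (dataT3c …) 𝔠.b₀ 𝔠.p₀ K k` — the residual step row `Fibre49AC` (R3D-01) at the trivial new history,
whose right side carries the transported trivial mass `T_k[w·m_k(triv)]`; under `HaarCompatT3 F` that factor is `≤ 1` a.e. (§2), and the upper gathering §1 turns the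
piece exponent into the (41)-exponent of level `k+1`. [cite: Balaban1985UV3, (41) p.266 and (55)-(58) pp.269-270; Balaban1985Averaging, (10) p.19] -/
theorem AlphaInputsT3AC.OfV2At.dataT3c_oneStepUpperTrivAt_of_haarCompat (hH : HaarCompatT3 F) (K k : ℕ) (hk : k + 1 ≤ K) :
    OneStepUpperTrivAt (h.dataT3c hc γ hγ hγ1 π) 𝔠.b₀ 𝔠.p₀ K k hk := by
  -- the package's data of run `K`, its (α) step row at `k`, the step leaves, the gathering
  have hle := T3Scales_window F 𝔠 γ hγ hγ1 K
  have st := (h.pkgAtV2 hc γ hγ hγ1 K).run.steps k hk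
  have R := stepResidualsAC_of_alpha hle k hk st
  have hgath := fun U => ineq41_exponent_succ_le_triv_of_leaves (stepLeavesOfAC k hk R) hk U
  have h49 := st.fibre49 (Hist.triv _ (k + 1))
  -- abbreviations in the tower's letters
  let T : TowerRun := (h.pkgAtV2 hc γ hγ hγ1 K).T
  let E : ℝ := (h.pkgAtV2 hc γ hγ hγ1 K).E
  let Pc := piecesAC 𝔠.lane (h.pkgAtV2 hc γ hγ hγ1 K).X (h.pkgAtV2 hc γ hγ hγ1 K).𝔖 k
  let S₃ := T3Scales F γ hγ (hγ1.trans (sq_min_one_le _ 𝔠.gamma0_pos)) K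
  -- the averaging of the package IS the route's, exactly Haar compatible by `hH`
  have hkm : k + 1 ≤ F.m + K := by omega
  have hav : ∀ j, j + 1 ≤ F.m + K → ((h.pkgAtV2 hc γ hγ hγ1 K).X).av j = BlockAveraging.blockAvg (P := F.P K) (j := j) ℰp :=
    fun j hj => avT3_of_le F K hj
  have hmeas : ∀ j, Measurable (((h.pkgAtV2 hc γ hγ hγ1 K).X).av j).avg := fun j => (((h.pkgAtV2 hc γ hγ hγ1 K).X).av_ac j).measurable
  have hmap : ∀ j, j + 1 ≤ (F.P K).m + (F.P K).K →
      (fieldMeasure (F.P K) j (Matrix.specialUnitaryGroup (Fin 2) ℂ)).map (((h.pkgAtV2 hc γ hγ hγ1 K).X).av j).avg =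
        fieldMeasure (F.P K) (j + 1) (Matrix.specialUnitaryGroup (Fin 2) ℂ) := by
    intro j hj
    have hj' : j + 1 ≤ F.m + K := hj
    rw [hav j hj']
    exact hH K j hj'
  have hrtT : ∀ g : GaugeField (F.P K) k (Matrix.specialUnitaryGroup (Fin 2) ℂ) → ℝ,
      (rt F K k hkm).T g = rnTransport (((h.pkgAtV2 hc γ hγ hγ1 K).X).av k).avg g := fun g => by
    rw [hav k hkm]; rfl
  have hε1 : eps1Of S₃ 𝔠.lane.carrier k = θBal F.L γ 𝔠.b₀ 𝔠.p₀ (K - k) :=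
    (h.pkgAtV2 hc γ hγ hγ1 K).toPkgAt.eps1_eq k (by omega)
  -- the (41)-trivial integrand of `Fibre49AC` and its relation to the upper envelope of the datum
  let g : GaugeField (F.P K) k (Matrix.specialUnitaryGroup (Fin 2) ℂ) → ℝ := fun U =>
    Real.exp (-(T.mainT k (T.triv k) U) + T.Pint k (T.triv k) U - T.Ecst k + T.Zterm k (T.triv k) + T.Rm k)
  have hZk : T.Zterm k (T.triv k) = 0 := T.Zterm_triv k
  have hup_eq : ∀ U, upperTriv (h.dataT3c hc γ hγ hγ1 π) K k U = Real.exp E * g U := by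
    intro U
    rw [upperTriv_eq_exp]
    show Real.exp ((-(T.mainT k (T.triv k) U) + T.Pint k (T.triv k) U - (T.Ecst k - E)) + T.Rm k) =
      Real.exp E * Real.exp (-(T.mainT k (T.triv k) U) + T.Pint k (T.triv k) U - T.Ecst k + T.Zterm k (T.triv k) + T.Rm k)
    rw [hZk, ← Real.exp_add]
    congr 1
    ring
  -- the mass and the weights of the AC tower at the trivial history
  let w : GaugeField (F.P K) k (Matrix.specialUnitaryGroup (Fin 2) ℂ) → ℝ := fun U =>
    stepWeight 𝔠.lane.carrier.M₁ (rcolOf S₃ 𝔠.lane.carrier) (eps1Of S₃ 𝔠.lane.carrier) (epsSOf S₃ 𝔠.lane.carrier) k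
      (Hist.triv (F.P K) (k + 1)) U
  let m : GaugeField (F.P K) k (Matrix.specialUnitaryGroup (Fin 2) ℂ) → ℝ := fun U =>
    massRecAC 𝔠.lane.carrier.M₁ (rcolOf S₃ 𝔠.lane.carrier) (eps1Of S₃ 𝔠.lane.carrier) (epsSOf S₃ 𝔠.lane.carrier)
      ((h.pkgAtV2 hc γ hγ hγ1 K).X).av k (Hist.triv (F.P K) k) U
  let χ : GaugeField (F.P K) k (Matrix.specialUnitaryGroup (Fin 2) ℂ) → ℝ := fun U =>
    chiB 𝔠.lane.carrier.M₁ (rcolOf S₃ 𝔠.lane.carrier) (eps1Of S₃ 𝔠.lane.carrier) k (Hist.triv (F.P K) (k + 1)) U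
  let cg : GaugeField (F.P K) k (Matrix.specialUnitaryGroup (Fin 2) ℂ) → ℝ := fun U => χ U * g U
  -- the (49)-factor at the trivial new history IS the window indicator of level `k`
  have hchiB : ∀ (f : GaugeField (F.P K) k (Matrix.specialUnitaryGroup (Fin 2) ℂ) → ℝ) (U : GaugeField (F.P K) k (Matrix.specialUnitaryGroup (Fin 2) ℂ)),
      χ U * f U = {W' : GaugeField (F.P K) k (Matrix.specialUnitaryGroup (Fin 2) ℂ) | PlaqSmall (θBal F.L γ 𝔠.b₀ 𝔠.p₀ (K - k)) W'}.indicator f U := by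
    intro f U
    have e : χ U = if PlaqSmall (eps1Of S₃ 𝔠.lane.carrier k) U then 1 else 0 :=
      Balaban3D.Proofs.FibreClash.chiB_triv_eq (S := S₃) k 𝔠.lane.carrier.M₁ (rcolOf S₃ 𝔠.lane.carrier) (eps1Of S₃ 𝔠.lane.carrier) U
    rw [e, hε1]
    by_cases hU : PlaqSmall (θBal F.L γ 𝔠.b₀ 𝔠.p₀ (K - k)) U
    · rw [if_pos hU, one_mul, Set.indicator_of_mem (show U ∈ {W' | PlaqSmall (θBal F.L γ 𝔠.b₀ 𝔠.p₀ (K - k)) W'} from hU)]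
    · rw [if_neg hU, zero_mul, Set.indicator_of_notMem (show U ∉ {W' | PlaqSmall (θBal F.L γ 𝔠.b₀ 𝔠.p₀ (K - k)) W'} from hU)]
  have hPK : (F.P K).m + (F.P K).K = F.m + K := rfl
  have hkPK : k ≤ (F.P K).m + (F.P K).K := by rw [hPK]; omega
  have hkPK1 : k + 1 ≤ (F.P K).m + (F.P K).K := by rw [hPK]; exact hkm
  have hw1 : ∀ U, w U = 1 := fun U => stepWeight_triv _ _ _ _ hkPK U
  have hm1 : m =ᵐ[fieldMeasure (F.P K) k (Matrix.specialUnitaryGroup (Fin 2) ℂ)] fun _ => (1 : ℝ) :=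
    massRecAC_triv_ae_eq_one_of_map _ _ _ _ _ hmeas hmap k hkPK
  have hTm : rnTransport (((h.pkgAtV2 hc γ hγ hγ1 K).X).av k).avg (fun U => w U * m U)
      ≤ᵐ[fieldMeasure (F.P K) (k + 1) (Matrix.specialUnitaryGroup (Fin 2) ℂ)] fun _ => (1 : ℝ) :=
    transport_mass_triv_le_one_ae_of_map _ _ _ _ _ hmeas hmap k hkPK1
  -- integrability of `χ·g` (bounded measurable weight times the exponential of a measurable exponent bounded above)
  have hmain : ∀ U, T.mainT k (T.triv k) U = (S₃.gk k)⁻¹ ^ 2 * S₃.actionEta k ((h.pkgAtV2 hc γ hγ hγ1 K).UkH k (Hist.triv (F.P K) k) U) :=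
    fun _ => rfl
  have hgi : Integrable cg (fieldMeasure (F.P K) k (Matrix.specialUnitaryGroup (Fin 2) ℂ)) := by
    refine Balaban3D.Proofs.Transport48.integrable_weight_mul_exp (measurable_chiB _ _ _ k _) (chiB_nonneg _ _ _ k _) (chiB_le_one _ _ _ k _)
      ?_ (c := (h.pkgAtV2 hc γ hγ hγ1 K).𝔄.cP k - T.Ecst k + T.Zterm k (T.triv k) + T.Rm k) ?_
    · simp_rw [hmain]
      exact ((((measurable_const.mul ((Bound55Std.measurable_actionEta (S := S₃) k).comp (st.hU _))).neg.add (st.hPm _)).sub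
        measurable_const).add measurable_const).add measurable_const
    · intro U
      have h0 : 0 ≤ T.mainT k (T.triv k) U := by
        rw [hmain]; exact mul_nonneg (sq_nonneg _) (Bound55Std.actionEta_nonneg (S := S₃) k _)
      have h2 : T.Pint k (T.triv k) U ≤ (h.pkgAtV2 hc γ hγ hγ1 K).𝔄.cP k := st.hPb _ U
      linarith
  -- `Fibre49AC`'s left integrand IS `χ·g` a.e. (weight `1`, mass `1` a.e.): same transport
  have hcongr : rnTransport (((h.pkgAtV2 hc γ hγ hγ1 K).X).av k).avg cg =
      rnTransport (((h.pkgAtV2 hc γ hγ hγ1 K).X).av k).avg (fun U => w U * χ U * (m U * g U)) := by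
    refine rnTransport_congr_ae ?_ (fun U => mul_nonneg (chiB_nonneg _ _ _ k _ U) (Real.exp_pos _).le)
      (fun U => mul_nonneg (mul_nonneg (stepWeight_nonneg _ _ _ _ k _ U) (chiB_nonneg _ _ _ k _ U))
        (mul_nonneg (massRecAC_nonneg _ _ _ _ _ k _ U) (Real.exp_pos _).le))
    filter_upwards [hm1] with U hU
    rw [hw1 U, hU]
    ring
  -- homogeneity for the route normalisation `e^{E}`
  have hhom := rnTransport_const_mul_ae (((h.pkgAtV2 hc γ hγ hγ1 K).X).av k).avg cg
    (fun U => mul_nonneg (chiB_nonneg _ _ _ k _ U) (Real.exp_pos _).le) hgi (Real.exp_nonneg E)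
  -- the restricted upper envelope of level `k` IS `e^{E}·χ·g`
  have hind : {W' : GaugeField (F.P K) k (Matrix.specialUnitaryGroup (Fin 2) ℂ) | PlaqSmall (θBal F.L γ 𝔠.b₀ 𝔠.p₀ (K - k)) W'}.indicator
      (upperTriv (h.dataT3c hc γ hγ hγ1 π) K k) = fun U => Real.exp E * cg U := by
    funext U
    rw [← hchiB _ U, hup_eq U]
    show χ U * (Real.exp E * g U) = Real.exp E * (χ U * g U)
    ring
  -- the goal
  show ∀ᵐ W ∂fieldMeasure (F.P K) (k + 1) (Matrix.specialUnitaryGroup (Fin 2) ℂ),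
    PlaqSmall (θBal F.L γ 𝔠.b₀ 𝔠.p₀ (K - (k + 1))) W →
      (rt F K k hkm).T ({W' : GaugeField (F.P K) k (Matrix.specialUnitaryGroup (Fin 2) ℂ) |
          PlaqSmall (θBal F.L γ 𝔠.b₀ 𝔠.p₀ (K - k)) W'}.indicator (upperTriv (h.dataT3c hc γ hγ hγ1 π) K k)) W ≤
        upperTriv (h.dataT3c hc γ hγ hγ1 π) K (k + 1) W
  rw [hind, hrtT]
  filter_upwards [h49, hhom, hTm] with W h49W hhomW hTmW
  intro _
  -- the upper envelope of level `k+1` in the tower's letters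
  have hup1 : upperTriv (h.dataT3c hc γ hγ hγ1 π) K (k + 1) W =
      Real.exp E * Real.exp (-(T.mainT (k + 1) (T.triv (k + 1)) W) + T.Pint (k + 1) (T.triv (k + 1)) W - T.Ecst (k + 1)
        + T.Zterm (k + 1) (T.triv (k + 1)) + T.Rm (k + 1)) := by
    rw [upperTriv_eq_exp, T.Zterm_triv (k + 1)]
    show Real.exp ((-(T.mainT (k + 1) (T.triv (k + 1)) W) + T.Pint (k + 1) (T.triv (k + 1)) W - (T.Ecst (k + 1) - E)) + T.Rm (k + 1)) = _
    rw [← Real.exp_add]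
    congr 1
    ring
  -- the (α) row, the trivial mass `≤ 1`, the gathering
  have key : rnTransport (((h.pkgAtV2 hc γ hγ hγ1 K).X).av k).avg (fun U => w U * χ U * (m U * g U)) W ≤
      Real.exp (-(T.mainT (k + 1) (T.triv (k + 1)) W) + T.Pint (k + 1) (T.triv (k + 1)) W - T.Ecst (k + 1)
        + T.Zterm (k + 1) (T.triv (k + 1)) + T.Rm (k + 1)) :=
    calc rnTransport (((h.pkgAtV2 hc γ hγ hγ1 K).X).av k).avg (fun U => w U * χ U * (m U * g U)) W
        ≤ rnTransport (((h.pkgAtV2 hc γ hγ hγ1 K).X).av k).avg (fun U => w U * m U) W *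
            Real.exp (-(T.mainT (k + 1) (T.triv (k + 1)) W) - T.Ecst k
              + (Pc.logσ₀ + Pc.dg * Real.log (S₃.gk k)) * Pc.starB (T.triv (k + 1)) + Pc.logZU (T.triv (k + 1)) W + Pc.Pold (T.triv (k + 1)) W
              + T.Zterm k (Pc.proj (T.triv (k + 1))) + T.Rm k + Pc.logFl (T.triv (k + 1)) W) := h49W
      _ ≤ 1 * Real.exp (-(T.mainT (k + 1) (T.triv (k + 1)) W) - T.Ecst k
              + (Pc.logσ₀ + Pc.dg * Real.log (S₃.gk k)) * Pc.starB (T.triv (k + 1)) + Pc.logZU (T.triv (k + 1)) W + Pc.Pold (T.triv (k + 1)) W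
              + T.Zterm k (Pc.proj (T.triv (k + 1))) + T.Rm k + Pc.logFl (T.triv (k + 1)) W) :=
          mul_le_mul_of_nonneg_right hTmW (Real.exp_pos _).le
      _ ≤ Real.exp (-(T.mainT (k + 1) (T.triv (k + 1)) W) + T.Pint (k + 1) (T.triv (k + 1)) W - T.Ecst (k + 1)
              + T.Zterm (k + 1) (T.triv (k + 1)) + T.Rm (k + 1)) := by
          rw [one_mul]
          exact Real.exp_le_exp.mpr (hgath W)
  rw [hup1]
  calc rnTransport (((h.pkgAtV2 hc γ hγ hγ1 K).X).av k).avg (fun U => Real.exp E * cg U) W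
      = Real.exp E * rnTransport (((h.pkgAtV2 hc γ hγ hγ1 K).X).av k).avg cg W := hhomW
    _ = Real.exp E * rnTransport (((h.pkgAtV2 hc γ hγ hγ1 K).X).av k).avg (fun U => w U * χ U * (m U * g U)) W := by rw [hcongr]
    _ ≤ Real.exp E * Real.exp (-(T.mainT (k + 1) (T.triv (k + 1)) W) + T.Pint (k + 1) (T.triv (k + 1)) W - T.Ecst (k + 1)
        + T.Zterm (k + 1) (T.triv (k + 1)) + T.Rm (k + 1)) := mul_le_mul_of_nonneg_left key (Real.exp_nonneg E)

end Upper

/-! ## §4 Conjunct (A) at the datum from the v2 package and exact Haar compatibility -/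

section Assembly

variable {F : T3Family} {𝔠 : AlphaConsts F.L (suGroupModel 2).N} {a₀ a₁ : ℝ}
  (h : AlphaInputsT3AC.OfV2At F 𝔠 a₀ a₁) (hc : 0 < a₀ ∧ 0 < a₁ ∧ 𝔠.B₃ * a₁ ≤ a₀) (γ : ℝ) (hγ : 0 < γ)
  (hγ1 : γ ≤ (min 𝔠.gamma0 1) ^ 2) (π : AlphaInputsT3AC.PolymerT3 F)

/-- **FINDING F-g3-1, CONSTRUCTIVE FORM — `RepAtHeights` FOR THE LANE'S DATUM FROM THE v2 (α) PACKAGE AND EXACT HAAR COMPATIBILITY**: given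
`OfV2At F 𝔠 a₀ a₁`, `HaarCompatT3 F` and the adapter's thresholds on the coupling (`θBal n ≤ a₁`, `B₃θBal n ≤ ε₀ ≤ a₀`, `4θBal n < ε₀`), the intended witness
`D = OfV2At.dataT3c` of v5h STUB 3′ carries [Balaban1985UV3] (41) ∧ (47) at the trivial history for the RESTRICTED height densities, two-sided with slack `Rm`:
`RepAtHeights D 𝔠.b₀ 𝔠.p₀ ε₀` — conjunct (A) of the stub, with exactly ONE input beyond the stub's own hypothesis (E6′, NOT IN PRINT).
[cite: Balaban1985UV3, (41) p.266 and (47) p.267; Balaban1985Averaging, (10) p.19] -/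
theorem AlphaInputsT3AC.OfV2At.repAtHeights_dataT3c_of_haarCompat (hH : HaarCompatT3 F) (ε₀ : ℝ) (hε : 0 < ε₀) (hhi : ε₀ ≤ a₀)
    (ha₁ : ∀ n, θBal F.L γ 𝔠.b₀ 𝔠.p₀ n ≤ a₁) (hlo : ∀ n, 𝔠.B₃ * θBal F.L γ 𝔠.b₀ 𝔠.p₀ n ≤ ε₀)
    (h4 : ∀ n, 4 * θBal F.L γ 𝔠.b₀ 𝔠.p₀ n < ε₀) :
    RepAtHeights (h.dataT3c hc γ hγ hγ1 π) 𝔠.b₀ 𝔠.p₀ ε₀ :=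
  h.repAtHeights_dataT3c_of_upperRows hc γ hγ hγ1 π ε₀ hε hhi ha₁ hlo h4
    (fun K j hjK => h.dataT3c_oneStepUpperTrivAt_of_haarCompat hc γ hγ hγ1 π hH K j hjK)

end Assembly

end Summit.QuantumFields.YangMills.Theorems

end
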